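import Mathlib.RingTheory.MvPolynomial.WeightedHomogeneous
import Mathlib.RingTheory.MvPolynomial.Basic
import Mathlib.RingTheory.Ideal.Maps
import Mathlib.Algebra.MvPolynomial.Eval
import HarnessLib

/-!
# Gröbner degenerations: the multi-parameter family `t ↦ t^{-W}·V(I)` over `𝔸^ι`

For an ideal `I ⊆ R[x_σ]` and finitely many NATURAL weight vectors `W i : σ → ℕ` (`i : ι`), the
GRÖBNER DEGENERATION of `I` along `W` is the family over `Spec R[t_ι]` whose fibre over the torus
point `t` is the translate `t^{-W}·V(I)` and whose fibre over `t = 0` is the initial degeneration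
`V(in_W(I))` (max-convention: `in_w(f)` = the terms of `f` of LARGEST `w`-weight). Algebraically
(Eisenbud, *Commutative Algebra*, §15.8, Thm. 15.17, for one integral weight `λ`: "`ĩ_λ(f) :=
t^{d} f(t^{-λ₁}x₁, …, t^{-λ_r}x_r)`, `d` the largest weight of a term of `f` … `Ĩ` the ideal
generated by all `ĩ_λ(f)`, `f ∈ I` … `A[t]/Ĩ` is free over `k[t]`, its fibre over `t = 0` is
`A/in_λ(I)` and over `t = 1` is `A/I`"; several weights at once as in the Gröbner-fan / tropical
compactification literature: Maclagan–Sturmfels §2.4–2.5, Tevelev 2007 §2–3):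

* `twistExponent W f a : ι →₀ ℕ` — the exponent `μ(f) − W·a` of `t` in front of the term `x^a` of
  the twist, where `μ(f)_i = max_{b ∈ supp f} ⟨W i, b⟩` (`MvPolynomial.weightedTotalDegree`) and
  `(W·a)_i = ⟨W i, a⟩` (`Finsupp.weight`); natural subtraction is harmless since `⟨W i, a⟩ ≤ μ(f)_i`
  on the support (`weight_le_weightedTotalDegree`... `le_weightedTotalDegree`);
* `twist W f = t^{μ(f)} · f(t^{-W} x) = Σ_a f_a t^{μ(f) − W·a} x^a ∈ R[t_ι][x_σ]` — Eisenbud's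
  `ĩ_λ(f)`;
* `grobnerDegeneration W I ⊆ R[t_ι][x_σ]` — the ideal of the family: the SATURATION with respect to
  `∏ t_i` of the ideal generated by the twists of the members of `I` (so that the total space is
  the schematic closure of the family over the torus `{∏ t_i ≠ 0}`, i.e. `t`-torsion free);
* API: `coeff_twist`, `twist_zero`, `mem_grobnerDegeneration_iff`, `twist_mem_grobnerDegeneration`,
  `mem_grobnerDegeneration_of_mul_prod_pow_mem` (saturatedness).

The THEOREMS (freeness over `R[t]` when the weights lie in one Gröbner cone — Eisenbud 15.17 /
Tevelev 2007 Thm. 1.7; identification of the fibres with initial degenerations; hence flatness and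
the regularity of tropical compactifications of schön varieties) are the business of the route
`ResolutionOfSingularities/TropicalLinks` (crux `SchonResolves`, memo `Cruxes/SchonResolves/KERNEL.md`,
(P1)–(P2)) and are not stated here; this file only fixes the objects.

## References

* D. Eisenbud, *Commutative Algebra with a View Toward Algebraic Geometry*, GTM 150 (1995), §15.8,
  Thm. 15.17. [Eisenbud1995]
* D. Maclagan, B. Sturmfels, *Introduction to Tropical Geometry*, GSM 161 (2015), §2.4–2.5.
  [MaclaganSturmfels2015]
* J. Tevelev, *Compactifications of subvarieties of tori*, Amer. J. Math. 129 (2007), §3, Thm. 1.7.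
  [Tevelev2007]
-/

noncomputable section

namespace Literature.RingTheory.MvPolynomial

open _root_.MvPolynomial Finsupp

universe u v w

variable {R : Type u} [CommSemiring R] {σ : Type v} {ι : Type w}

/-! ## The twist `t^{μ(f)} f(t^{-W}x)` -/

section Twist

variable [Finite ι] (W : ι → σ → ℕ)

/-- The exponent of `t` in front of the term `x^a` of the twist of `f`:
`(μ(f)_i − ⟨W i, a⟩)_i` where `μ(f)_i = max_{b ∈ supp f} ⟨W i, b⟩` is the `W i`-weighted total
degree (max-convention). [cite: Eisenbud1995, §15.8 (definition of `ĩ_λ`)] -/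
def twistExponent (f : MvPolynomial σ R) (a : σ →₀ ℕ) : ι →₀ ℕ :=
  Finsupp.equivFunOnFinite.symm fun i => weightedTotalDegree (W i) f - weight (W i) a

/-- Unfolding of `twistExponent`. [folklore] -/
@[simp] theorem twistExponent_apply (f : MvPolynomial σ R) (a : σ →₀ ℕ) (i : ι) :
    twistExponent W f a i = weightedTotalDegree (W i) f - weight (W i) a := by
  simp [twistExponent]

/-- On the support the subtraction is a genuine difference:
`twistExponent W f a i + ⟨W i, a⟩ = μ(f)_i`. [folklore] -/
theorem twistExponent_add_weight (f : MvPolynomial σ R) {a : σ →₀ ℕ} (ha : a ∈ f.support) (i : ι) :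
    twistExponent W f a i + weight (W i) a = weightedTotalDegree (W i) f := by
  rw [twistExponent_apply, tsub_add_cancel_of_le (le_weightedTotalDegree (W i) ha)]

/-- **The twist** `t^{μ(f)} · f(t^{-W}x) = Σ_{a} f_a · t^{μ(f) − W·a} · x^a ∈ R[t_ι][x_σ]` of
`f ∈ R[x_σ]` along the weights `W` (Eisenbud's `ĩ_λ(f)`; for `t` in the torus it cuts out the
translate `t^{-W}·V(f)`, and `twist W f ≡ in_W(f) (mod t)` on the terms attaining all the maxima).
[cite: Eisenbud1995, §15.8, Thm. 15.17] -/
def twist (f : MvPolynomial σ R) : MvPolynomial σ (MvPolynomial ι R) :=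
  ∑ a ∈ f.support, monomial a (monomial (twistExponent W f a) (coeff a f))

/-- The coefficients of the twist: `[x^a] twist(f) = f_a · t^{μ(f) − W·a}`. [folklore] -/
theorem coeff_twist [DecidableEq σ] (f : MvPolynomial σ R) (a : σ →₀ ℕ) :
    coeff a (twist W f) = monomial (twistExponent W f a) (coeff a f) := by
  rw [twist, coeff_sum]
  simp only [coeff_monomial]
  rw [Finset.sum_ite_eq']
  split_ifs with h
  · rfl
  · rw [MvPolynomial.notMem_support_iff.1 h, monomial_zero]

/-- The twist of `0` is `0`. [folklore] -/
@[simp] theorem twist_zero : twist W (0 : MvPolynomial σ R) = 0 := by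
  rw [twist, MvPolynomial.support_zero, Finset.sum_empty]

/-- The support of the twist is the support of `f`. [folklore] -/
theorem mem_support_twist_iff (f : MvPolynomial σ R) (a : σ →₀ ℕ) :
    a ∈ (twist W f).support ↔ a ∈ f.support := by
  classical
  rw [MvPolynomial.mem_support_iff, MvPolynomial.mem_support_iff, coeff_twist, Ne, monomial_eq_zero]

end Twist

/-! ## The ideal of the Gröbner degeneration (saturated with respect to `∏ tᵢ`) -/

section Family

variable [Fintype ι] (W : ι → σ → ℕ)

/-- **The ideal of the Gröbner degeneration of `I` along `W`**: the elements `g ∈ R[t_ι][x_σ]`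
such that `g · (∏ tᵢ)^M` lies, for some `M`, in the ideal generated by the twists `twist W f`,
`f ∈ I` — the saturation that makes the total space `R[t][x] ⧸ grobnerDegeneration W I` the
schematic closure of the family `t ↦ t^{-W}·V(I)` over the torus (no `t`-torsion).
[cite: Eisenbud1995, §15.8, Thm. 15.17]; [cite: Tevelev2007, §3] for several weights. -/
def grobnerDegeneration (I : Ideal (MvPolynomial σ R)) : Ideal (MvPolynomial σ (MvPolynomial ι R)) where
  carrier := {g | ∃ M : ℕ, g * (C (∏ i, X i)) ^ M ∈
    Ideal.span (twist W '' (I : Set (MvPolynomial σ R)))}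
  add_mem' := by
    rintro g h ⟨M, hM⟩ ⟨N, hN⟩
    refine ⟨M + N, ?_⟩
    rw [add_mul]
    refine Ideal.add_mem _ ?_ ?_
    · rw [pow_add, ← mul_assoc]
      exact Ideal.mul_mem_right _ _ hM
    · rw [add_comm M N, pow_add, ← mul_assoc]
      exact Ideal.mul_mem_right _ _ hN
  zero_mem' := ⟨0, by rw [zero_mul]; exact Ideal.zero_mem _⟩
  smul_mem' := by
    rintro c g ⟨M, hM⟩
    refine ⟨M, ?_⟩
    rw [smul_eq_mul, mul_assoc]
    exact Ideal.mul_mem_left _ _ hM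

variable {W}

/-- Membership in the degeneration ideal. [folklore] -/
theorem mem_grobnerDegeneration_iff {I : Ideal (MvPolynomial σ R)}
    {g : MvPolynomial σ (MvPolynomial ι R)} :
    g ∈ grobnerDegeneration W I ↔ ∃ M : ℕ, g * (C (∏ i, X i)) ^ M ∈
      Ideal.span (twist W '' (I : Set (MvPolynomial σ R))) :=
  Iff.rfl

/-- The ideal generated by the twists is contained in the degeneration ideal. [folklore] -/
theorem span_twist_le_grobnerDegeneration (I : Ideal (MvPolynomial σ R)) :
    Ideal.span (twist W '' (I : Set (MvPolynomial σ R))) ≤ grobnerDegeneration W I :=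
  fun _ hg => ⟨0, by rwa [pow_zero, mul_one]⟩

/-- The twist of a member of `I` lies in the degeneration ideal. [folklore] -/
theorem twist_mem_grobnerDegeneration {I : Ideal (MvPolynomial σ R)} {f : MvPolynomial σ R}
    (hf : f ∈ I) : twist W f ∈ grobnerDegeneration W I :=
  span_twist_le_grobnerDegeneration I (Ideal.subset_span ⟨f, hf, rfl⟩)

/-- **The degeneration ideal is saturated with respect to `∏ tᵢ`**: if `g · (∏ tᵢ)^N` lies in it
then so does `g` (the total space has no `t`-torsion). [folklore] -/
theorem mem_grobnerDegeneration_of_mul_prod_pow_mem {I : Ideal (MvPolynomial σ R)}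
    {g : MvPolynomial σ (MvPolynomial ι R)} {N : ℕ}
    (h : g * (C (∏ i, X i)) ^ N ∈ grobnerDegeneration W I) : g ∈ grobnerDegeneration W I := by
  obtain ⟨M, hM⟩ := h
  exact ⟨N + M, by rwa [pow_add, ← mul_assoc]⟩

/-- `grobnerDegeneration W` is monotone in the ideal. [folklore] -/
theorem grobnerDegeneration_mono {I J : Ideal (MvPolynomial σ R)} (h : I ≤ J) :
    grobnerDegeneration W I ≤ grobnerDegeneration W J := by
  rintro g ⟨M, hM⟩
  exact ⟨M, Ideal.span_mono (Set.image_mono h) hM⟩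

end Family

end Literature.RingTheory.MvPolynomial

end
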